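import Summits.Ventures.HodgeRepro2.T5ConvolutionNatural
import Mathlib.MeasureTheory.Function.L2Space
import Mathlib.MeasureTheory.Group.Integral

/-!
# T5ConvolutionAdjoint — `η(f)* = η(f*)`, and `η(f)` as a bounded natural symmetric operator

Cell pub-hodge-repro2, seat p5, Tier 5 (route/T5-N4-p5.md, N4.3 v13 (B1)–(B2)).  [DE] Lemma
9.2.7 (quoted at l. 157) takes a *-CLOSED subspace `A ⊆ C_c(G)`: with `f*(g) := conj (f (g⁻¹))`
one has `η(f)* = η(f*)` for a unitary `ρ` and an inversion-invariant Haar measure, so that the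
self-adjoint operators `η(f)`, `f = f*`, are available — the self-adjointness hypothesis of row
49.  Kernel form:

* `inner_etaOp_left`: for `ρ` unitary (`star (ρ g) = ρ g⁻¹`) and `μ` inversion invariant,
  `⟪η(f) v, w⟫ = ⟪v, η(f*) w⟫` whenever both integrands are integrable (Mathlib's
  `integral_inner`, `integral_conj`, `integral_inv_eq_self`); hence `etaOp_symmetric` for `f* = f`;
* `etaOpL : E →L[ℂ] E`: `η(f)` packaged as a CONTINUOUS LINEAR MAP with `‖η(f)‖ ≤ ∫ |f|`
  (`LinearMap.mkContinuous`; integrability of the integrand from `‖ρ g v‖ = ‖v‖`,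
  `integrable_smul_apply`), NATURAL (`etaOpL_mem`, `etaOpL_mem_of_hasCompactSupport` — row 50)
  and SYMMETRIC for `f* = f` (`isSymmetric_etaOpL`, as a `LinearMap.IsSymmetric`).

So row 49's decomposition theorem applies to the family `{η(f) ∣ f ∈ A, f* = f}` of a *-closed `A`
as soon as its members are COMPACT and jointly non-degenerate — exactly the two inputs of
[DE] Lemma 9.2.7 that stay prose [C] (Lemmas 9.2.3–9.2.6 on `L²(Γ\G)`).  Mathlib only besides
row 50's import chain.  Axioms: propext, Classical.choice, Quot.sound.  README §8(d): uses an
L-value-free non-vanishing device: NO.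
-/

namespace Summit.Ventures.HodgeRepro2.T5ConvolutionAdjoint

open MeasureTheory
open Summit.Ventures.HodgeRepro2.T5ConvolutionNatural
open scoped InnerProductSpace ComplexConjugate

variable {E : Type*} [NormedAddCommGroup E] [InnerProductSpace ℂ E] [CompleteSpace E]
variable {G : Type*} [Group G]

/-- The involution `f ↦ f*`, `f*(g) = conj (f g⁻¹)`. -/
def starFun (f : G → ℂ) : G → ℂ := fun g => conj (f g⁻¹)

/-- `f** = f`. -/
theorem starFun_starFun (f : G → ℂ) : starFun (starFun f) = f := by
  funext g
  simp only [starFun, inv_inv, RCLike.conj_conj]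

/-- Unitarity in the form `⟪ρ g x, y⟫ = ⟪x, ρ g⁻¹ y⟫`. -/
theorem inner_map_left_eq {ρ : G →* (E →L[ℂ] E)} (hρ : ∀ g, star (ρ g) = ρ g⁻¹) (g : G)
    (x y : E) : ⟪ρ g x, y⟫_ℂ = ⟪x, ρ g⁻¹ y⟫_ℂ := by
  rw [← ContinuousLinearMap.adjoint_inner_right, ← ContinuousLinearMap.star_eq_adjoint, hρ]

variable [MeasurableSpace G]

/-- **`η(f)* = η(f*)`**: for a unitary `ρ` and an inversion-invariant `μ`,
`⟪η(f) v, w⟫ = ⟪v, η(f*) w⟫`. -/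
theorem inner_etaOp_left [MeasurableInv G] (μ : Measure G) [μ.IsInvInvariant]
    (ρ : G →* (E →L[ℂ] E)) (hρ : ∀ g, star (ρ g) = ρ g⁻¹) (f : G → ℂ) (v w : E)
    (hint₁ : Integrable (fun g => f g • ρ g v) μ)
    (hint₂ : Integrable (fun g => starFun f g • ρ g w) μ) :
    ⟪etaOp μ ρ f v, w⟫_ℂ = ⟪v, etaOp μ ρ (starFun f) w⟫_ℂ := by
  unfold etaOp
  calc ⟪∫ g, f g • ρ g v ∂μ, w⟫_ℂ
      = conj (⟪w, ∫ g, f g • ρ g v ∂μ⟫_ℂ) := (inner_conj_symm _ _).symm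
    _ = conj (∫ g, ⟪w, f g • ρ g v⟫_ℂ ∂μ) := by rw [integral_inner hint₁]
    _ = ∫ g, conj ⟪w, f g • ρ g v⟫_ℂ ∂μ := integral_conj.symm
    _ = ∫ g, starFun f g⁻¹ * ⟪v, ρ g⁻¹ w⟫_ℂ ∂μ := by
        congr 1
        funext g
        rw [inner_smul_right, map_mul, inner_conj_symm, inner_map_left_eq hρ, starFun, inv_inv]
    _ = ∫ g, starFun f g * ⟪v, ρ g w⟫_ℂ ∂μ :=
        integral_inv_eq_self (fun g => starFun f g * ⟪v, ρ g w⟫_ℂ) μ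
    _ = ∫ g, ⟪v, starFun f g • ρ g w⟫_ℂ ∂μ := by
        congr 1
        funext g
        rw [inner_smul_right]
    _ = ⟪v, ∫ g, starFun f g • ρ g w ∂μ⟫_ℂ := integral_inner hint₂ v

/-- **Self-adjointness**: for `f* = f`, `η(f)` is symmetric — the hypothesis of row 49 for the
operators of a *-closed family. -/
theorem etaOp_symmetric [MeasurableInv G] (μ : Measure G) [μ.IsInvInvariant]
    (ρ : G →* (E →L[ℂ] E)) (hρ : ∀ g, star (ρ g) = ρ g⁻¹) (f : G → ℂ) (hf : starFun f = f)
    (v w : E) (hint₁ : Integrable (fun g => f g • ρ g v) μ)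
    (hint₂ : Integrable (fun g => f g • ρ g w) μ) :
    ⟪etaOp μ ρ f v, w⟫_ℂ = ⟪v, etaOp μ ρ f w⟫_ℂ := by
  have h := inner_etaOp_left μ ρ hρ f v w hint₁ (by rw [hf]; exact hint₂)
  rwa [hf] at h

/-! ### `η(f)` as a bounded operator -/

omit [MeasurableSpace G] in
/-- A unitary `ρ` is isometric: `‖ρ g v‖ = ‖v‖`. -/
theorem norm_apply_eq_of_star_eq {ρ : G →* (E →L[ℂ] E)} (hρ : ∀ g, star (ρ g) = ρ g⁻¹) (g : G)
    (v : E) : ‖ρ g v‖ = ‖v‖ := by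
  rw [norm_eq_sqrt_re_inner (𝕜 := ℂ) (ρ g v), norm_eq_sqrt_re_inner (𝕜 := ℂ) v,
    T5SchurIsotypicStep4.inner_map_map_of_star_eq hρ]

variable (μ : Measure G) (ρ : G →* (E →L[ℂ] E))

/-- The integrand `g ↦ f g • ρ g v` is integrable for integrable `f`, unitary `ρ` and a strongly
measurable `g ↦ ρ g v`. -/
theorem integrable_smul_apply (hρ : ∀ g, star (ρ g) = ρ g⁻¹) {f : G → ℂ} (hf : Integrable f μ)
    (v : E) (hmeas : AEStronglyMeasurable (fun g => ρ g v) μ) :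
    Integrable (fun g => f g • ρ g v) μ :=
  (hf.norm.mul_const ‖v‖).mono' (hf.aestronglyMeasurable.smul hmeas)
    (Filter.Eventually.of_forall fun g => by
      rw [norm_smul, norm_apply_eq_of_star_eq hρ])

/-- `η(f)` as a linear map. -/
noncomputable def etaOpₗ (hρ : ∀ g, star (ρ g) = ρ g⁻¹) {f : G → ℂ} (hf : Integrable f μ)
    (hmeas : ∀ v : E, AEStronglyMeasurable (fun g => ρ g v) μ) : E →ₗ[ℂ] E where
  toFun v := etaOp μ ρ f v
  map_add' v w := by
    unfold etaOp
    simp only [map_add, smul_add]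
    exact integral_add (integrable_smul_apply μ ρ hρ hf v (hmeas v))
      (integrable_smul_apply μ ρ hρ hf w (hmeas w))
  map_smul' c v := by
    unfold etaOp
    simp only [map_smul, RingHom.id_apply]
    rw [← integral_smul]
    congr 1
    funext g
    rw [smul_comm]

/-- The bound `‖η(f) v‖ ≤ (∫ |f|) ‖v‖`. -/
theorem norm_etaOp_le (hρ : ∀ g, star (ρ g) = ρ g⁻¹) {f : G → ℂ} (v : E) :
    ‖etaOp μ ρ f v‖ ≤ (∫ g, ‖f g‖ ∂μ) * ‖v‖ := by
  unfold etaOp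
  refine (norm_integral_le_integral_norm _).trans (le_of_eq ?_)
  rw [← integral_mul_const]
  congr 1
  funext g
  rw [norm_smul, norm_apply_eq_of_star_eq hρ]

/-- **`η(f)` as a bounded operator** (`‖η(f)‖ ≤ ∫ |f|`). -/
noncomputable def etaOpL (hρ : ∀ g, star (ρ g) = ρ g⁻¹) {f : G → ℂ} (hf : Integrable f μ)
    (hmeas : ∀ v : E, AEStronglyMeasurable (fun g => ρ g v) μ) : E →L[ℂ] E :=
  (etaOpₗ μ ρ hρ hf hmeas).mkContinuous (∫ g, ‖f g‖ ∂μ) fun v => norm_etaOp_le μ ρ hρ v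

/-- `etaOpL` is `η(f)` on points. -/
theorem etaOpL_apply (hρ : ∀ g, star (ρ g) = ρ g⁻¹) {f : G → ℂ} (hf : Integrable f μ)
    (hmeas : ∀ v : E, AEStronglyMeasurable (fun g => ρ g v) μ) (v : E) :
    etaOpL μ ρ hρ hf hmeas v = etaOp μ ρ f v :=
  rfl

/-- **Natural** (finite measure): `etaOpL` maps closed stable subspaces into themselves. -/
theorem etaOpL_mem [IsFiniteMeasure μ] (hρ : ∀ g, star (ρ g) = ρ g⁻¹) {f : G → ℂ}
    (hf : Integrable f μ) (hmeas : ∀ v : E, AEStronglyMeasurable (fun g => ρ g v) μ)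
    {U : Submodule ℂ E} (hUc : IsClosed (U : Set E)) (hUs : ∀ g, ∀ u ∈ U, ρ g u ∈ U) :
    ∀ u ∈ U, etaOpL μ ρ hρ hf hmeas u ∈ U := fun u hu =>
  etaOp_mem μ ρ f hUc hUs hu (integrable_smul_apply μ ρ hρ hf u (hmeas u))

/-- **Natural** (`f ∈ C_c(G)`, `μ` finite on compacts, `ρ` strongly continuous). -/
theorem etaOpL_mem_of_hasCompactSupport [TopologicalSpace G] [OpensMeasurableSpace G]
    [IsFiniteMeasureOnCompacts μ] (hρ : ∀ g, star (ρ g) = ρ g⁻¹)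
    (hρc : ∀ v : E, Continuous fun g => ρ g v) {f : G → ℂ} (hfc : Continuous f)
    (hfs : HasCompactSupport f) (hf : Integrable f μ)
    (hmeas : ∀ v : E, AEStronglyMeasurable (fun g => ρ g v) μ)
    {U : Submodule ℂ E} (hUc : IsClosed (U : Set E)) (hUs : ∀ g, ∀ u ∈ U, ρ g u ∈ U) :
    ∀ u ∈ U, etaOpL μ ρ hρ hf hmeas u ∈ U := fun _ hu =>
  etaOp_mem_of_hasCompactSupport μ ρ hρc hfc hfs hUc hUs hu

/-- **Symmetric** for `f* = f` (row 51), as a `LinearMap.IsSymmetric` — the hypothesis of row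
49's decomposition theorem. -/
theorem isSymmetric_etaOpL [MeasurableInv G] [μ.IsInvInvariant] (hρ : ∀ g, star (ρ g) = ρ g⁻¹)
    {f : G → ℂ} (hf : Integrable f μ) (hstar : starFun f = f)
    (hmeas : ∀ v : E, AEStronglyMeasurable (fun g => ρ g v) μ) :
    (etaOpL μ ρ hρ hf hmeas : E →ₗ[ℂ] E).IsSymmetric := fun v w =>
  etaOp_symmetric μ ρ hρ f hstar v w (integrable_smul_apply μ ρ hρ hf v (hmeas v))
    (integrable_smul_apply μ ρ hρ hf w (hmeas w))

end Summit.Ventures.HodgeRepro2.T5ConvolutionAdjoint
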